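import Summits.ValiantsHypothesis.ValiantsHypothesis.Theorems.KPlusLogSqLawTropicalBExchangeSector
import Summits.ValiantsHypothesis.ValiantsHypothesis.Theorems.KPlusLogSqLawTropicalBSplitDefs
import Summits.ValiantsHypothesis.ValiantsHypothesis.Theorems.KPlusLogSqLawTropicalBSplitGlue

/-!
# Route «KPlusLogSqLaw», crux `TropicalB` (stmt-ValiantsHypothesis-19771) — the EXCHANGE SECTOR, part 3:
# carries are permutation moves; the unsigned-row form; the COVER LAW (`M-concave rank R ⇒ n + 1 ≤ R·(m(K−1)+1)`)

HONEST FRAMING.  Helper toward the registered stubs `stub_tropThin` / `stub_tropFat` of `Cruxes/TropicalB/Lines/birth.lean` (crux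
`Summit.ValiantsHypothesis.ValiantsHypothesis.Theses.KPlusLogSqLaw.TropicalB`, item stmt-ValiantsHypothesis-19771, route KPlusLogSqLaw,
DRAFT; cell `pub-symmetroid`, seat val-sym-trop-p1 g9, 2026-08-27; `--supports … --as helper`).  Continuation of `…TropicalBExchangeStage` /
`…TropicalBExchangeSector` (exchange axiom (M-EXC) of the coloured-matching value function ⇒ every dominant chain has `n ≤ m(K−1)`; carries).
Structural statements about dominant chains; nothing here bounds `TropicalB` for general designs, and nothing bears on `WeakLifting`,
DoorA26 / DoorA34, `MatrixDescartes` (stmt-ValiantsHypothesis-18050) or VP ≠ VNP.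

* `upper_le_of_samePerm` — a step of a dominant chain that KEEPS the permutation is never a carry: at a common permutation every column's
  class moves up in exponent (`TropicalCensus.d_lt_of_dominant`), so (sorted exponents) every upper class count weakly increases.  Hence
  `card_carries_le_card_permChanges`: carries ⊆ permutation-changing steps — for every design, at every format.  With
  `chain_le_of_carries` (part 2): the super-linear content of the crux is PERMUTATION TURNOVER THAT IS NOT DOMINANCE-MONOTONE (refines the
  switch budget `…TropicalBSwitchBudget.chain_le_permChanges_add`: dominance-monotone permutation changes are free of charge).
* `designRowD_of_exchange` — the law of part 2 in the cell's unsigned-row currency: `Monotone d → (M-EXC) → DesignRowD d v ε (m·(K−1))`.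
* `chain_succ_le_of_exchange_cover` — **COVER LAW.**  If the presence pattern `ε` is covered by `R` sub-patterns `εᵣ` (every `εᵣ`-present
  cell is `ε`-present, and every `ε`-present TERM is `εᵣ`-present for some `r`) each of which satisfies (M-EXC) with the same valuations,
  then every dominant chain of `(d, v, ε)` has `n + 1 ≤ R·(m(K−1)+1)`: a chain term present in `εᵣ` is dominant for `εᵣ` (fewer competitors),
  and on the terms of one sub-pattern the rank sum is injective (`upper_le_of_dominant` + `rankSum_lt_of_upper_le` are TWO-TERM statements,
  so no re-indexing of sub-chains is needed).  Reading: `TropicalB` would follow from a cover of every design's present terms by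
  `2^{O(K + log₂² m)}` exchange sub-patterns («M-concave rank»); SHIFT-THREE is covered by its `m` phases (one rotation each, separable) —
  consistent with its `≈ m²/2` terms.  Nothing bounds the cover number of a general design.
[kernel arguments: this file; (M-EXC): Murota, Discrete Convex Analysis (2003), Ch. 6]
-/

set_option linter.dupNamespace false
set_option autoImplicit false

namespace Summit.ValiantsHypothesis.ValiantsHypothesis.Theorems.KPlusLogSqLaw.ExchangeSector

open Summit.ValiantsHypothesis.ValiantsHypothesis.Theorems.MatrixDescartes.Negative
open Summit.ValiantsHypothesis.ValiantsHypothesis.Theorems.LacunarySymmetroidMatrixDescartes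
open Summit.ValiantsHypothesis.ValiantsHypothesis.Theorems.LacunarySymmetroidMatrixDescartes.TropicalCensus
open scoped BigOperators
open Finset

variable {m K : ℕ}

/-! ## 1. Carries are permutation moves -/

/-- **A step that keeps the permutation is dominance-monotone.**  If `(σ, μ)` is the unique optimum at `θa` and `(σ, ν)` (same
permutation) at `θb > θa`, and the exponents are sorted, then every upper class count of `ν` is at least that of `μ`. [folklore] -/
theorem upper_le_of_samePerm (d : Fin K → ℕ) (hd : Monotone d) (v ε : Fin m → Fin m → Fin K → ℤ) {θa θb : ℤ} (hab : θa < θb)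
    (σ : Equiv.Perm (Fin m)) (μ ν : Fin m → Fin K) (ha : IsDominant d v ε θa (σ, μ)) (hb : IsDominant d v ε θb (σ, ν)) (c : ℕ) :
    (univ.filter fun b => c ≤ (μ b : ℕ)).card ≤ (univ.filter fun b => c ≤ (ν b : ℕ)).card := by
  refine card_le_card fun b hmem => ?_
  rw [mem_filter] at hmem ⊢
  refine ⟨mem_univ _, hmem.2.trans ?_⟩
  by_cases h : μ b = ν b
  · rw [h]
  · have hlt := d_lt_of_dominant d v ε hab σ μ ν ha hb b h
    by_contra hcon
    push Not at hcon
    have : d (ν b) ≤ d (μ b) := hd (Fin.le_def.mpr hcon.le)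
    omega

open Classical in
/-- **Carries ⊆ permutation-changing steps** (every design, sorted exponents): along a dominant chain the number of carries (steps at
which some upper class count drops) is at most the number of steps that change the permutation. [folklore] -/
theorem card_carries_le_card_permChanges (d : Fin K → ℕ) (hd : Monotone d) (v ε : Fin m → Fin m → Fin K → ℤ)
    {n : ℕ} (θ : Fin (n + 1) → ℤ) (p : Fin (n + 1) → Equiv.Perm (Fin m) × (Fin m → Fin K))
    (hθ : StrictMono θ) (hdom : ∀ k, IsDominant d v ε (θ k) (p k)) :
    (univ.filter fun k : Fin n => ¬ ∀ c : ℕ, (univ.filter fun b => c ≤ ((p k.castSucc).2 b : ℕ)).card ≤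
        (univ.filter fun b => c ≤ ((p k.succ).2 b : ℕ)).card).card ≤
      (univ.filter fun k : Fin n => (p k.castSucc).1 ≠ (p k.succ).1).card := by
  refine card_le_card fun k hk => ?_
  rw [mem_filter] at hk ⊢
  refine ⟨mem_univ _, fun heq => hk.2 fun c => ?_⟩
  have ha : IsDominant d v ε (θ k.castSucc) ((p k.castSucc).1, (p k.castSucc).2) := by rw [Prod.mk.eta]; exact hdom _
  have hb : IsDominant d v ε (θ k.succ) ((p k.castSucc).1, (p k.succ).2) := by rw [heq, Prod.mk.eta]; exact hdom _
  exact upper_le_of_samePerm d hd v ε (hθ Fin.castSucc_lt_succ) _ _ _ ha hb c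

open Classical in
/-- **Carry law, permutation form**: `n ≤ m(K−1) + (m(K−1)+1)·#{permutation-changing carries}` — in particular a design whose chain
changes the permutation `P` times has `n ≤ m(K−1) + (m(K−1)+1)·P`, and dominance-monotone permutation changes cost nothing. [this file] -/
theorem chain_le_of_permChanging_carries (d : Fin K → ℕ) (hd : Monotone d) (v ε : Fin m → Fin m → Fin K → ℤ)
    {n : ℕ} (θ : Fin (n + 1) → ℤ) (p : Fin (n + 1) → Equiv.Perm (Fin m) × (Fin m → Fin K))
    (hθ : StrictMono θ) (hdom : ∀ k, IsDominant d v ε (θ k) (p k)) (hne : ∀ k : Fin n, p k.castSucc ≠ p k.succ) :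
    n ≤ m * (K - 1) + (m * (K - 1) + 1) *
      (univ.filter fun k : Fin n => (p k.castSucc).1 ≠ (p k.succ).1 ∧
        ¬ ∀ c : ℕ, (univ.filter fun b => c ≤ ((p k.castSucc).2 b : ℕ)).card ≤
          (univ.filter fun b => c ≤ ((p k.succ).2 b : ℕ)).card).card := by
  have h := chain_le_of_carries d v ε θ p hθ hdom hne
  have hsub : (univ.filter fun k : Fin n => ¬ ∀ c : ℕ, (univ.filter fun b => c ≤ ((p k.castSucc).2 b : ℕ)).card ≤
        (univ.filter fun b => c ≤ ((p k.succ).2 b : ℕ)).card).card ≤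
      (univ.filter fun k : Fin n => (p k.castSucc).1 ≠ (p k.succ).1 ∧
        ¬ ∀ c : ℕ, (univ.filter fun b => c ≤ ((p k.castSucc).2 b : ℕ)).card ≤
          (univ.filter fun b => c ≤ ((p k.succ).2 b : ℕ)).card).card := by
    refine card_le_card fun k hk => ?_
    rw [mem_filter] at hk ⊢
    refine ⟨mem_univ _, ?_, hk.2⟩
    -- a carry changes the permutation
    intro heq
    apply hk.2
    intro c
    have ha : IsDominant d v ε (θ k.castSucc) ((p k.castSucc).1, (p k.castSucc).2) := by rw [Prod.mk.eta]; exact hdom _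
    have hb : IsDominant d v ε (θ k.succ) ((p k.castSucc).1, (p k.succ).2) := by rw [heq, Prod.mk.eta]; exact hdom _
    exact upper_le_of_samePerm d hd v ε (hθ Fin.castSucc_lt_succ) _ _ _ ha hb c
  have hmono := Nat.mul_le_mul_left (m * (K - 1) + 1) hsub
  omega

/-! ## 2. The unsigned-row form of the law -/

/-- **`DesignRowD` form**: a design in the exchange sector (sorted exponents) satisfies the cell's unsigned row bound with `B = m(K−1)`.
[this file] -/
theorem designRowD_of_exchange (d : Fin K → ℕ) (hd : Monotone d) (v ε : Fin m → Fin m → Fin K → ℤ)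
    (hex : ∀ p q : Equiv.Perm (Fin m) × (Fin m → Fin K), termSign ε p ≠ 0 → termSign ε q ≠ 0 →
      ∀ i : Fin K, (univ.filter fun b => q.2 b = i).card < (univ.filter fun b => p.2 b = i).card →
        ∃ j : Fin K, (univ.filter fun b => p.2 b = j).card < (univ.filter fun b => q.2 b = j).card ∧
          ∃ p' q' : Equiv.Perm (Fin m) × (Fin m → Fin K), termSign ε p' ≠ 0 ∧ termSign ε q' ≠ 0 ∧
            (∀ l, (univ.filter fun b => p'.2 b = l).card + (if l = i then 1 else 0) =
              (univ.filter fun b => p.2 b = l).card + (if l = j then 1 else 0)) ∧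
            (∀ l, (univ.filter fun b => q'.2 b = l).card + (if l = j then 1 else 0) =
              (univ.filter fun b => q.2 b = l).card + (if l = i then 1 else 0)) ∧
            (∑ b, v (p'.1 b) b (p'.2 b)) + (∑ b, v (q'.1 b) b (q'.2 b)) ≤
              (∑ b, v (p.1 b) b (p.2 b)) + (∑ b, v (q.1 b) b (q.2 b))) :
    DesignRowD d v ε (m * (K - 1)) :=
  fun _ θ p hθ hdom hne => chain_le_of_exchange d hd v ε hex θ p hθ hdom hne

/-! ## 3. The cover law -/

/-- presence passes from a sub-pattern to the pattern. [folklore] -/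
theorem termSign_ne_zero_of_sub (ε ε' : Fin m → Fin m → Fin K → ℤ) (hsub : ∀ a b l, ε' a b l ≠ 0 → ε a b l ≠ 0)
    (q : Equiv.Perm (Fin m) × (Fin m → Fin K)) (hq : termSign ε' q ≠ 0) : termSign ε q ≠ 0 := by
  rw [termSign_ne_zero_iff] at hq ⊢
  exact fun i => hsub _ _ _ (hq i)

/-- dominance passes from the pattern to every sub-pattern in which the term is present. [folklore] -/
theorem isDominant_of_sub (d : Fin K → ℕ) (v ε ε' : Fin m → Fin m → Fin K → ℤ) (hsub : ∀ a b l, ε' a b l ≠ 0 → ε a b l ≠ 0)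
    {θ : ℤ} {q : Equiv.Perm (Fin m) × (Fin m → Fin K)} (hq : IsDominant d v ε θ q) (hpres : termSign ε' q ≠ 0) :
    IsDominant d v ε' θ q :=
  ⟨hpres, fun q' hne hq' => hq.2 q' hne (termSign_ne_zero_of_sub ε ε' hsub q' hq')⟩

/-- **COVER LAW.**  Let the presence pattern `ε` be covered by `R` sub-patterns `εs r` — every `εs r`-present cell is `ε`-present, every
`ε`-present term is `εs r`-present for some `r` — and let every `(d, v, εs r)` satisfy the term-level exchange axiom.  Then every dominant
chain of `(d, v, ε)` with distinct consecutive terms has `n + 1 ≤ R·(m(K−1)+1)`. [this file] -/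
theorem chain_succ_le_of_exchange_cover (d : Fin K → ℕ) (hd : Monotone d) (v ε : Fin m → Fin m → Fin K → ℤ) {R : ℕ}
    (εs : Fin R → Fin m → Fin m → Fin K → ℤ) (hsub : ∀ r a b l, εs r a b l ≠ 0 → ε a b l ≠ 0)
    (hcover : ∀ q : Equiv.Perm (Fin m) × (Fin m → Fin K), termSign ε q ≠ 0 → ∃ r, termSign (εs r) q ≠ 0)
    (hex : ∀ r, ∀ p q : Equiv.Perm (Fin m) × (Fin m → Fin K), termSign (εs r) p ≠ 0 → termSign (εs r) q ≠ 0 →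
      ∀ i : Fin K, (univ.filter fun b => q.2 b = i).card < (univ.filter fun b => p.2 b = i).card →
        ∃ j : Fin K, (univ.filter fun b => p.2 b = j).card < (univ.filter fun b => q.2 b = j).card ∧
          ∃ p' q' : Equiv.Perm (Fin m) × (Fin m → Fin K), termSign (εs r) p' ≠ 0 ∧ termSign (εs r) q' ≠ 0 ∧
            (∀ l, (univ.filter fun b => p'.2 b = l).card + (if l = i then 1 else 0) =
              (univ.filter fun b => p.2 b = l).card + (if l = j then 1 else 0)) ∧
            (∀ l, (univ.filter fun b => q'.2 b = l).card + (if l = j then 1 else 0) =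
              (univ.filter fun b => q.2 b = l).card + (if l = i then 1 else 0)) ∧
            (∑ b, v (p'.1 b) b (p'.2 b)) + (∑ b, v (q'.1 b) b (q'.2 b)) ≤
              (∑ b, v (p.1 b) b (p.2 b)) + (∑ b, v (q.1 b) b (q.2 b)))
    {n : ℕ} (θ : Fin (n + 1) → ℤ) (p : Fin (n + 1) → Equiv.Perm (Fin m) × (Fin m → Fin K))
    (hθ : StrictMono θ) (hdom : ∀ k, IsDominant d v ε (θ k) (p k)) (hne : ∀ k : Fin n, p k.castSucc ≠ p k.succ) :
    n + 1 ≤ R * (m * (K - 1) + 1) := by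
  classical
  -- assign to each chain index a covering sub-pattern
  have hchoice : ∀ k : Fin (n + 1), ∃ r : Fin R, termSign (εs r) (p k) ≠ 0 := fun k => hcover (p k) (hdom k).1
  choose r hr using hchoice
  -- the pair (pattern, rank sum) is injective on the chain
  set Φ : Fin (n + 1) → ℕ := fun k => ∑ b, (((p k).2 b : ℕ)) with hΦ
  have hsm := slope_strictMono_of_chainD d v ε θ p hθ hdom hne
  have hinj : Function.Injective fun k => (r k, Φ k) := by
    intro k k' hkk'
    simp only [Prod.mk.injEq] at hkk'
    obtain ⟨hrk, hΦk⟩ := hkk'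
    by_contra hne'
    rcases lt_or_gt_of_ne hne' with hlt | hlt
    · have hdk : IsDominant d v (εs (r k)) (θ k) (p k) := isDominant_of_sub d v ε _ (hsub _) (hdom k) (hr k)
      have hdk' : IsDominant d v (εs (r k)) (θ k') (p k') :=
        isDominant_of_sub d v ε _ (hsub _) (hdom k') (by rw [hrk]; exact hr k')
      have hup := upper_le_of_dominant d hd v (εs (r k)) (hex (r k)) (hθ hlt) hdk hdk'
      have hlt' := rankSum_lt_of_upper_le d hup (ne_of_lt (hsm hlt))
      simp only [hΦ] at hΦk
      omega
    · have hdk' : IsDominant d v (εs (r k')) (θ k') (p k') := isDominant_of_sub d v ε _ (hsub _) (hdom k') (hr k')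
      have hdk : IsDominant d v (εs (r k')) (θ k) (p k) :=
        isDominant_of_sub d v ε _ (hsub _) (hdom k) (by rw [← hrk]; exact hr k)
      have hup := upper_le_of_dominant d hd v (εs (r k')) (hex (r k')) (hθ hlt) hdk' hdk
      have hlt' := rankSum_lt_of_upper_le d hup (ne_of_lt (hsm hlt))
      simp only [hΦ] at hΦk
      omega
  -- its image lies in `Fin R × [0, m(K−1)]`
  have hrange : ∀ k, (fun k => (r k, Φ k)) k ∈ (univ : Finset (Fin R)) ×ˢ range (m * (K - 1) + 1) := by
    intro k
    simp only [mem_product, mem_univ, true_and, mem_range]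
    exact Nat.lt_succ_of_le (rankSum_le (p k).2)
  have hcard := card_le_card_of_injOn (s := (univ : Finset (Fin (n + 1))))
    (t := (univ : Finset (Fin R)) ×ˢ range (m * (K - 1) + 1)) (fun k => (r k, Φ k)) (fun k _ => hrange k)
    (fun a _ b _ h => hinj h)
  rw [card_univ, Fintype.card_fin, card_product, card_univ, Fintype.card_fin, card_range] at hcard
  exact hcard

end Summit.ValiantsHypothesis.ValiantsHypothesis.Theorems.KPlusLogSqLaw.ExchangeSector
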